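import Summits.QuantumFields.YangMills.Theorems.BalabanUVNodesK0VariationalThm1Top7Engine
import Summits.QuantumFields.YangMills.Theorems.BalabanUVNodesK0VariationalThm1Co7Floor
import Summits.QuantumFields.YangMills.Theorems.BalabanUVNodesN07Thm1Co7FromProp8
import Literature.MathematicalPhysics.QuantumFieldTheory.Balaban1983to89.Node00.Record12BgRowCoClassCPM
import Literature.MathematicalPhysics.QuantumFieldTheory.Balaban1983to89.Node00.CriticalOnFibreTop
import Literature.MathematicalPhysics.QuantumFieldTheory.Balaban1983to89.Node00.LargeFieldBackgroundCoPOfRecordFaces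

/-!
# K0⁗ ROW P11 — FILE 22B: ★★ THE EMPTY-SUPPORT INSTANCE `VariationalThm1RegSepCoP7 F N B₃ a₀ a₁ → L⁵∕32 < B₃` (kernel certificate of node00-def-P11's
# LOCATED-P11-EMPTY-SUPPORT) AND ★★ THE FLOOR `2L² ≤ B₃` FOR THE GUARDED EDITIONS 12d `VariationalThm1RegSepTop7M` (every `Sup`) ∕ `VariationalThm1RegSepCoP7M`

Cell `pub-ymgap`, seat `pub-ymgap-dag-n21-c` g8 (R134 (a) N21 NE7c s1; K0⁗ ROW P11 negative side of record; INBOX INTENT-2 of 2026-08-27 ≈10:55Z).  Filed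
`--kind proof --supports stmt-QuantumFields-20289 --as helper`.  Part B of FILE 22 (A = `…K0VariationalThm1Top7Engine`: the corner engine `sq_L_lt_of_top7BodyAt`).
[15] = [Balaban1985Variational]; [6] = [Balaban1985RegularSpaces]; [III] = [Balaban1988Convergent].

WHAT IS CERTIFIED.  (1) node00-def-P11 g3 LOCATED-P11-EMPTY-SUPPORT (INBOX l.18760, self-located, Lean-probed but NOT filed by the definer): 12c's `VariationalThm1RegSepCoP7`
quantifies `∀ ν : Stage7Numerics` inside the Prop; at `ν.M₁ = 0` the torus has NO `0`-cubes (`cubeIndices (F.P K) 0 = ∅`), so def-R's support `suppDomOfRecord F ν K Ω = hullD (F.P K) 0 1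
(Ω 1) = ∅` (def-R 22′b `suppDomOfRecord_of_M₁_eq_zero`) and all three scale-0 clauses (class, datum (7)₀, conclusion (8)₀) are VACUOUS, while (8)₁ still ranges over the PINNED corner plaquette of `Ω₁`; the data (7)₁ see a corner
twist only through the (0.4) averages, at `≤ 16t∕L³` (20C).  Engine in the EMPTY mode (`ρ₀ = ρ₁ = 32∕L³`): ★★ `pow_five_div_lt_of_variationalThm1RegSepCoP7 : VariationalThm1RegSepCoP7 F N B₃ a₀ a₁
→ L⁵∕32 < B₃` (every `N ≥ 2`, `0 < a₀`, `0 < a₁`) — 12c's unguarded sentence is UNINHABITED for every `B₃ ≤ L⁵∕32` (`L ≥ 13` ⇒ `B₃ ≤ 11 603`), two orders above the displayed floor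
`2L²`; print excludes the instance ([6] (1.3)–(1.6): `M₁` a positive integer; [15] (1) p.277 `Ω₀ ⊇ Ω₁`), and 12d's repair `…CoP7M` (`0 < ν.M₁`) is the edition Cut B keys on.
(2) For the GUARDED editions the corner engine in the FLOOR mode (`ν₀ = numerics7OfRecord₁₂`, `M₁ = 1`; `ρ₁ = L²∕max(B₃,1)`, `ρ₀ = 2ρ₁`) gives ★★ `two_sq_L_le_of_variationalThm1RegSepTop7M`
(every `Sup`) and ★★ `two_sq_L_le_of_variationalThm1RegSepCoP7M` — node00-def-K0a's 16b∕16c re-keyed on `…CoP7M` still carry the NECESSARY letter `2L² ≤ B₃` (print: `B₃ = B₃(d, L)`;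
[6] p.77 L12–14 reads plaquette sets by the «at least one vertex» convention, so the corner plaquette IS in print's (8)₁ range).
CONTENTS (theorems only; the empty support itself is node00-def-R 22′b's `suppDomOfRecord_of_M₁_eq_zero`, cited BY NAME).  §2 ★★ `pow_five_div_lt_of_variationalThm1RegSepTop7_of_supp_empty`,
★★ `pow_five_div_lt_of_variationalThm1RegSepCoP7`, `not_variationalThm1RegSepCoP7_of_le_pow_five`, `variationalThm1RegSepCoP7_degenerate_of_le_pow_five`; §3 ★★
`two_sq_L_le_of_variationalThm1RegSepTop7M`, `not_variationalThm1RegSepTop7M_of_lt_two_sq`, ★★ `two_sq_L_le_of_variationalThm1RegSepCoP7M`, `not_variationalThm1RegSepCoP7M_of_lt_two_sq`,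
`variationalThm1RegSepCoP7M_degenerate_of_lt_two_sq` (all through the floor-mode wrapper `two_sq_L_le_of_top7BodyAt_record`); §4 (dag-ref-C g29's duty word, INBOX
l.18716) the floor BITES dag-n07-e's Proposition-8 facts: `two_sq_L_le_of_prop8RegSepPrinted`, `two_sq_L_le_of_prop8RegSepStep` (`0 < B₃`), `not_prop8RegSepStep_of_pos_of_lt_two_sq`,
`two_sq_L_le_of_prop8RegSepTopStep` (every `Sup`), `not_prop8RegSepTopStep_of_lt_two_sq`.
HONEST FRAMING: kernel certificates about TREE-typed facts; nothing of Bałaban asserted or refuted; K0⁗∕K0⁵ neither discharged nor refuted; N21 NOT discharged; NE7c NOT PRINTED ∕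
NOT PROVED; counts unmoved; no `def`, no `sorry`, no `instance`.
DEPENDENCES (by name): part A `sq_L_lt_of_top7BodyAt`; node00-def-P11 12b∕12c∕12d `VariationalThm1RegSepTop7`, `VariationalThm1RegSepCoP7.toTop7`, `VariationalThm1RegSepTop7M`,
`VariationalThm1RegSepCoP7M.toTop7M`, FILE 11 `variationalThm1RegSepCo7_of_prop8`; dag-n07-e `N07Thm1Co7FromProp8.variationalThm1RegSepCo7_of_prop8Step`, `Node00.CriticalOnFibreTop.
(Prop8RegSepTopStep, regular_of_isMinimizer_classTop_of_prop8TopStep)`; FILE 21C `K0VariationalThm1Top7Floor.two_sq_L_le_of_variationalThm1RegSepCo7`; node00-def-R 22′b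
`LargeFieldBackgroundCoPOfRecordFaces.suppDomOfRecord_of_M₁_eq_zero`; `numerics7OfRecord₁₂`.
-/

noncomputable section

open scoped Matrix.Norms.L2Operator

namespace Summit.QuantumFields.YangMills.Theorems.K0VariationalThm1Top7Engine

open Literature.MathematicalPhysics.QuantumFieldTheory.Balaban1983to89
open Literature.MathematicalPhysics.QuantumFieldTheory.Balaban1983to89.Node00
open Literature.MathematicalPhysics.QuantumFieldTheory.Balaban1983to89.T4Continuum
open B15DeterminingSets

/-! ## §2  ★★ THE EMPTY-SUPPORT INSTANCE: `VariationalThm1RegSepCoP7 F N B₃ a₀ a₁ → L⁵∕32 < B₃` -/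
section Empty

variable {F : T4Family} {N : ℕ} [NeZero N]

/-- **★★ 12b's FACT AT A TOP DOMAIN THAT IS EMPTY FOR SOME NUMERICS FORCES `L⁵∕32 < B₃`**: if `Sup ν₀ 1 Ω = ∅` for every `Ω` at some `ν₀`, then `VariationalThm1RegSepTop7 F N Sup B₃ a₀ a₁`
(`N ≥ 2`, `0 < a₀`, `0 < a₁`) implies `L⁵∕32 < B₃` — the corner engine in the EMPTY mode (`ρ₀ = ρ₁ = 32∕L³`: (7)₀ vacuous, (7)₁ by `16t∕L³ < 32t∕L³`, (8)₁ reads `L² < 32B₃∕L³`).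
[cite: Balaban1985Variational, (2),(6) p.278, Thm 1 (7)–(8) pp.278–279; Balaban1985RegularSpaces, (1.3)–(1.9) p.77; Balaban1988Convergent, (2.13) p.256 (bookkeeping)] -/
theorem pow_five_div_lt_of_variationalThm1RegSepTop7_of_supp_empty
    (Sup : (ν : Stage7Numerics) → (K : ℕ) → (ℕ → Set (Site (F.P K) 0)) → Set (Site (F.P K) 0)) (ν₀ : Stage7Numerics)
    (hSup : ∀ Ω : ℕ → Set (Site (F.P 1) 0), Sup ν₀ 1 Ω = ∅) (hN : 2 ≤ N) {B₃ a₀ a₁ : ℝ} (ha₀ : 0 < a₀) (ha₁ : 0 < a₁)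
    (h : VariationalThm1RegSepTop7 F N Sup B₃ a₀ a₁) : (F.L : ℝ) ^ 5 / 32 < B₃ := by
  have hL1 : (1 : ℝ) ≤ F.L := by exact_mod_cast F.hL.2.le
  have hL3pos : (0 : ℝ) < (F.L : ℝ) ^ 3 := by positivity
  have hρpos : (0 : ℝ) < 32 / (F.L : ℝ) ^ 3 := by positivity
  have key := sq_L_lt_of_top7BodyAt (F := F) (N := N) Sup ν₀ hN ha₀ ha₁ (ρ₀ := 32 / (F.L : ℝ) ^ 3) (ρ₁ := 32 / (F.L : ℝ) ^ 3) hρpos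
    (div_lt_div_of_pos_right (by norm_num) hL3pos) (by linarith only [hρpos]) (by linarith only [hρpos]) (Or.inr hSup)
    (fun s hsep => h ν₀ 1 (fun _ => (1 : ℝ)) 1 1 s hsep)
  rw [mul_div_assoc', lt_div_iff₀ hL3pos] at key
  rw [div_lt_iff₀ (by norm_num : (0 : ℝ) < 32)]
  calc (F.L : ℝ) ^ 5 = (F.L : ℝ) ^ 2 * (F.L : ℝ) ^ 3 := by ring
    _ < B₃ * 32 := key

/-- **★★ THE EMPTY-SUPPORT INSTANCE OF 12c: `VariationalThm1RegSepCoP7 F N B₃ a₀ a₁ → L⁵∕32 < B₃`** (every `N ≥ 2`, `0 < a₀`, `0 < a₁`) — at `ν₀ := {numerics7OfRecord₁₂ with M₁ := 0}`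
def-R's support is empty (22′b `suppDomOfRecord_of_M₁_eq_zero`), and 12c IS 12b's fact at that selector (`VariationalThm1RegSepCoP7.toTop7`).  node00-def-P11's LOCATED-P11-EMPTY-SUPPORT as a kernel certificate: the
unguarded v1.5 sentence is UNINHABITED for `B₃ ≤ L⁵∕32` (`L ≥ 13` ⇒ `B₃ ≤ 11 603`); 12d's `…CoP7M` (`0 < ν.M₁`) excludes the instance, print never had it ([6] (1.3)–(1.6)).
[cite: Balaban1985Variational, Thm 1 (7)–(8) pp.278–279; Balaban1985RegularSpaces, (1.3)–(1.6) p.77; Balaban1988Convergent, p.255, (2.13) p.256 (bookkeeping)] -/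
theorem pow_five_div_lt_of_variationalThm1RegSepCoP7 (hN : 2 ≤ N) {B₃ a₀ a₁ : ℝ} (ha₀ : 0 < a₀) (ha₁ : 0 < a₁)
    (h : VariationalThm1RegSepCoP7 F N B₃ a₀ a₁) : (F.L : ℝ) ^ 5 / 32 < B₃ :=
  pow_five_div_lt_of_variationalThm1RegSepTop7_of_supp_empty (fun ν K Ω => suppDomOfRecord F ν K Ω) { numerics7OfRecord₁₂ with M₁ := 0 }
    (fun Ω => suppDomOfRecord_of_M₁_eq_zero (F := F) _ rfl 1 Ω) hN ha₀ ha₁ h.toTop7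

/-- Hence `¬ VariationalThm1RegSepCoP7 F N B₃ a₀ a₁` for every `B₃ ≤ L⁵∕32` (`N ≥ 2`, `0 < a₀`, `0 < a₁`). [cite: Balaban1985Variational, Thm 1 (7)–(8) pp.278–279 (bookkeeping)] -/
theorem not_variationalThm1RegSepCoP7_of_le_pow_five (hN : 2 ≤ N) {B₃ a₀ a₁ : ℝ} (ha₀ : 0 < a₀) (ha₁ : 0 < a₁) (hB : B₃ ≤ (F.L : ℝ) ^ 5 / 32) :
    ¬ VariationalThm1RegSepCoP7 F N B₃ a₀ a₁ :=
  fun h => absurd (pow_five_div_lt_of_variationalThm1RegSepCoP7 hN ha₀ ha₁ h) (not_lt.mpr hB)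

/-- Truth set of 12c's unguarded fact up to `L⁵∕32`: only the degenerate corner `a₀ ≤ 0 ∨ a₁ ≤ 0`. [cite: Balaban1985Variational, Thm 1 (7)–(8) pp.278–279 (bookkeeping)] -/
theorem variationalThm1RegSepCoP7_degenerate_of_le_pow_five (hN : 2 ≤ N) {B₃ a₀ a₁ : ℝ} (hB : B₃ ≤ (F.L : ℝ) ^ 5 / 32)
    (h : VariationalThm1RegSepCoP7 F N B₃ a₀ a₁) : a₀ ≤ 0 ∨ a₁ ≤ 0 := by
  by_contra hne
  push Not at hne
  exact not_variationalThm1RegSepCoP7_of_le_pow_five hN hne.1 hne.2 hB h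

end Empty

/-! ## §3  ★★ THE FLOOR `2L² ≤ B₃` FOR THE GUARDED EDITIONS 12d `…Top7M` (every top domain) AND `…CoP7M` -/
section FloorM

variable {F : T4Family} {N : ℕ} [NeZero N]

/-- **★★ THE FLOOR MODE OF THE ENGINE AT THE RECORD's NUMERICS**: if the `VariationalThm1RegSepTop7`-shaped body holds at `(numerics7OfRecord₁₂, M = 1, g ≡ 1, K = k = 1)` (so
`M₁ = 1`: the guard `0 < ν.M₁` of 12d's `…Top7M` and of dag-n07-e's `Prop8RegSepTopStep` is met, and `k = 1 ≥ 1`), then `2L² ≤ B₃` (`N ≥ 2`, `0 < a₀`, `0 < a₁`): ratios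
`ρ₁ = L²∕max(B₃,1)`, `ρ₀ = 2ρ₁` (`t < δ₀` needs `max(B₃,1) < 2L²`; `16∕L³ < ρ₁` needs `16·max(B₃,1) < L⁵`), conclusion `L² < B₃L²∕max(B₃,1)` — absurd.
[cite: Balaban1985Variational, (2),(6) p.278, Thm 1 (7)–(8) pp.278–279; Balaban1985RegularSpaces, (1.3)–(1.9) p.77; Balaban1988Convergent, (2.12)–(2.13) p.256 (bookkeeping)] -/
theorem two_sq_L_le_of_top7BodyAt_record (Sup : (ν : Stage7Numerics) → (K : ℕ) → (ℕ → Set (Site (F.P K) 0)) → Set (Site (F.P K) 0))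
    (hN : 2 ≤ N) {B₃ a₀ a₁ : ℝ} (ha₀ : 0 < a₀) (ha₁ : 0 < a₁)
    (h : ∀ s : SeqOfRecord F numerics7OfRecord₁₂ 1 (fun _ => (1 : ℝ)) 1 1, Sect2.SeqSeparated numerics7OfRecord₁₂.M₁ s → ∀ (ε₀ : ℝ) (δ : ℕ → ℝ),
      (∀ n, n ≤ 1 → 0 < δ n ∧ δ n ≤ a₁ ∧ B₃ * δ n ≤ ε₀) → (∀ n, n < 1 → δ n ≤ 2 * δ (n + 1)) → (∀ n, n < 1 → δ (n + 1) ≤ 2 * δ n) → ε₀ ≤ a₀ →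
      ∀ W : MSField (F.P 1) (SU N), Sect2.DataSmall7PTop (avOfRecord F N 1) s.Ω (Sup numerics7OfRecord₁₂ 1 s.Ω) 1 δ W →
        ∀ U₀, IsMinimizer (avOfRecord F N 1)
            {U | (∀ n, n ≤ 1 → PlaqSmallOn (Sect2.omegaPlaqsTop s.Ω (Sup numerics7OfRecord₁₂ 1 s.Ω) n) (ε₀ * (F.P 1).eta n ^ 2) U) ∧
              Sect2.CoDivClassOnTop s.Ω (Sup numerics7OfRecord₁₂ 1 s.Ω) 1 ε₀ U} (genSet s.Ω 1) W U₀ →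
          (∀ n, n ≤ 1 → PlaqSmallOn (Sect2.omegaPlaqsTop s.Ω (Sup numerics7OfRecord₁₂ 1 s.Ω) n) (B₃ * δ n * (F.P 1).eta n ^ 2) U₀) ∧
            ∀ n, n ≤ 1 → Sect2.CoDivSmallOn (Sect2.omegaBondsTop s.Ω (Sup numerics7OfRecord₁₂ 1 s.Ω) n) (B₃ * δ n * (F.P 1).eta n ^ 3) U₀) :
    2 * (F.L : ℝ) ^ 2 ≤ B₃ := by
  by_contra hB
  rw [not_le] at hB
  have hLR : (12 : ℝ) ≤ F.L := by exact_mod_cast (show 12 ≤ F.L by have := F.hL11; omega)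
  have hL2pos : (0 : ℝ) < (F.L : ℝ) ^ 2 := by positivity
  have hL3pos : (0 : ℝ) < (F.L : ℝ) ^ 3 := by positivity
  have hL2ge : (1 : ℝ) ≤ (F.L : ℝ) ^ 2 := one_le_pow₀ (by linarith only [hLR])
  have hL3ge : (32 : ℝ) ≤ (F.L : ℝ) ^ 3 := by
    have h12 : (12 : ℝ) ^ 3 ≤ (F.L : ℝ) ^ 3 := pow_le_pow_left₀ (by norm_num) hLR 3
    norm_num at h12
    linarith only [h12]
  obtain ⟨β, hβ⟩ : ∃ β : ℝ, β = max B₃ 1 := ⟨_, rfl⟩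
  have hβ1 : 1 ≤ β := by rw [hβ]; exact le_max_right _ _
  have hβpos : 0 < β := by linarith only [hβ1]
  have hβB : B₃ ≤ β := by rw [hβ]; exact le_max_left _ _
  have hβL : β < 2 * (F.L : ℝ) ^ 2 := by rw [hβ]; exact max_lt hB (by linarith only [hL2ge])
  have hρ₁ : 16 / (F.L : ℝ) ^ 3 < (F.L : ℝ) ^ 2 / β := by
    rw [lt_div_iff₀ hβpos, div_mul_eq_mul_div, div_lt_iff₀ hL3pos]
    nlinarith only [hβL, hL3ge, hL2pos]
  have hc : 2 * ((F.L : ℝ) ^ 2 / β) ≤ 2 * ((F.L : ℝ) ^ 2 / β) := le_rfl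
  have hc' : (F.L : ℝ) ^ 2 / β ≤ 2 * (2 * ((F.L : ℝ) ^ 2 / β)) := by
    have : 0 ≤ (F.L : ℝ) ^ 2 / β := by positivity
    linarith only [this]
  have hmode : 1 < 2 * ((F.L : ℝ) ^ 2 / β) := by
    rw [← mul_div_assoc, one_lt_div hβpos]; exact hβL
  have key := sq_L_lt_of_top7BodyAt (F := F) (N := N) Sup numerics7OfRecord₁₂ hN ha₀ ha₁ (ρ₀ := 2 * ((F.L : ℝ) ^ 2 / β)) (ρ₁ := (F.L : ℝ) ^ 2 / β)
    (by positivity) hρ₁ hc hc' (Or.inl hmode) h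
  have hle : B₃ * ((F.L : ℝ) ^ 2 / β) ≤ (F.L : ℝ) ^ 2 := by
    calc B₃ * ((F.L : ℝ) ^ 2 / β) ≤ β * ((F.L : ℝ) ^ 2 / β) := mul_le_mul_of_nonneg_right hβB (by positivity)
      _ = (F.L : ℝ) ^ 2 := by field_simp
  exact absurd key (not_lt.mpr hle)

/-- **★★ THE FLOOR OF RECORD FOR 12d's GUARDED CLASS EDITION, EVERY TOP DOMAIN: `VariationalThm1RegSepTop7M F N Sup B₃ a₀ a₁ → 2L² ≤ B₃`** (`N ≥ 2`, `0 < a₀`, `0 < a₁`) — the floor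
mode at `numerics7OfRecord₁₂` (`M₁ = 1` meets the guard).  So 12d's repair of the empty-support instance leaves exactly the displayed letter `2L² ≤ B₃`.
[cite: Balaban1985Variational, Thm 1 (7)–(8) pp.278–279; Balaban1985RegularSpaces, (1.3)–(1.6) p.77; Balaban1988Convergent, (2.12)–(2.13) p.256 (bookkeeping)] -/
theorem two_sq_L_le_of_variationalThm1RegSepTop7M (Sup : (ν : Stage7Numerics) → (K : ℕ) → (ℕ → Set (Site (F.P K) 0)) → Set (Site (F.P K) 0))
    (hN : 2 ≤ N) {B₃ a₀ a₁ : ℝ} (ha₀ : 0 < a₀) (ha₁ : 0 < a₁)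
    (h : VariationalThm1RegSepTop7M F N Sup B₃ a₀ a₁) : 2 * (F.L : ℝ) ^ 2 ≤ B₃ :=
  two_sq_L_le_of_top7BodyAt_record Sup hN ha₀ ha₁ fun s hsep => h numerics7OfRecord₁₂ 1 (fun _ => (1 : ℝ)) 1 1 s hsep (by change 0 < 1; exact one_pos)

/-- Hence `¬ VariationalThm1RegSepTop7M F N Sup B₃ a₀ a₁` for every `B₃ < 2L²`, every top domain (`N ≥ 2`, `0 < a₀`, `0 < a₁`). [cite: Balaban1985Variational, Thm 1 (7)–(8) pp.278–279 (bookkeeping)] -/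
theorem not_variationalThm1RegSepTop7M_of_lt_two_sq (Sup : (ν : Stage7Numerics) → (K : ℕ) → (ℕ → Set (Site (F.P K) 0)) → Set (Site (F.P K) 0))
    (hN : 2 ≤ N) {B₃ a₀ a₁ : ℝ} (ha₀ : 0 < a₀) (ha₁ : 0 < a₁) (hB : B₃ < 2 * (F.L : ℝ) ^ 2) :
    ¬ VariationalThm1RegSepTop7M F N Sup B₃ a₀ a₁ :=
  fun h => absurd (two_sq_L_le_of_variationalThm1RegSepTop7M Sup hN ha₀ ha₁ h) (not_le.mpr hB)

/-- **★★ THE FLOOR OF RECORD FOR THE GUARDED v1.5 FACT: `VariationalThm1RegSepCoP7M F N B₃ a₀ a₁ → 2L² ≤ B₃`** (`N ≥ 2`, `0 < a₀`, `0 < a₁`) — 12d's `…CoP7M` IS `…Top7M` at the selector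
`suppDomOfRecord` (`VariationalThm1RegSepCoP7M.toTop7M`).  node00-def-K0a's closers re-keyed on `…CoP7M` carry this NECESSARY letter.
[cite: Balaban1985Variational, Thm 1 (7)–(8) pp.278–279; Balaban1988Convergent, (2.12)–(2.13) pp.256–257 (bookkeeping)] -/
theorem two_sq_L_le_of_variationalThm1RegSepCoP7M (hN : 2 ≤ N) {B₃ a₀ a₁ : ℝ} (ha₀ : 0 < a₀) (ha₁ : 0 < a₁)
    (h : VariationalThm1RegSepCoP7M F N B₃ a₀ a₁) : 2 * (F.L : ℝ) ^ 2 ≤ B₃ :=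
  two_sq_L_le_of_variationalThm1RegSepTop7M _ hN ha₀ ha₁ h.toTop7M

/-- Hence `¬ VariationalThm1RegSepCoP7M F N B₃ a₀ a₁` for every `B₃ < 2L²` (`N ≥ 2`, `0 < a₀`, `0 < a₁`). [cite: Balaban1985Variational, Thm 1 (7)–(8) pp.278–279 (bookkeeping)] -/
theorem not_variationalThm1RegSepCoP7M_of_lt_two_sq (hN : 2 ≤ N) {B₃ a₀ a₁ : ℝ} (ha₀ : 0 < a₀) (ha₁ : 0 < a₁) (hB : B₃ < 2 * (F.L : ℝ) ^ 2) :
    ¬ VariationalThm1RegSepCoP7M F N B₃ a₀ a₁ :=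
  fun h => absurd (two_sq_L_le_of_variationalThm1RegSepCoP7M hN ha₀ ha₁ h) (not_le.mpr hB)

/-- Truth set of the guarded v1.5 fact below the floor: only the degenerate corner `a₀ ≤ 0 ∨ a₁ ≤ 0`. [cite: Balaban1985Variational, Thm 1 (7)–(8) pp.278–279 (bookkeeping)] -/
theorem variationalThm1RegSepCoP7M_degenerate_of_lt_two_sq (hN : 2 ≤ N) {B₃ a₀ a₁ : ℝ} (hB : B₃ < 2 * (F.L : ℝ) ^ 2)
    (h : VariationalThm1RegSepCoP7M F N B₃ a₀ a₁) : a₀ ≤ 0 ∨ a₁ ≤ 0 := by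
  by_contra hne
  push Not at hne
  exact not_variationalThm1RegSepCoP7M_of_lt_two_sq hN hne.1 hne.2 hB h

end FloorM

/-! ## §4  dag-ref-C g29's duty word (INBOX l.18716): the floor BITES the consumers of dag-n07-e's Proposition-8 facts -/
section Prop8

variable {F : T4Family} {N : ℕ} [NeZero N]

open Summit.QuantumFields.YangMills.BalabanUVNodes.N07Thm1Co7FromProp8 (variationalThm1RegSepCo7_of_prop8Step)

/-- **`Prop8RegSepPrinted F N B₃ a₀ a₁ → 2L² ≤ B₃`** (`N ≥ 2`, `0 < a₀`, `0 < a₁`): node00-def-P11 FILE 11 §4 `variationalThm1RegSepCo7_of_prop8` ∘ FILE 21C's Co7 floor.  Every consumer of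
dag-n07-e's `Prop8RegSepPrinted` displays the letter. [cite: Balaban1985Variational, Prop. 8 p.304, Thm 1 (7)–(8) pp.278–279 (bookkeeping)] -/
theorem two_sq_L_le_of_prop8RegSepPrinted (hN : 2 ≤ N) {B₃ a₀ a₁ : ℝ} (ha₀ : 0 < a₀) (ha₁ : 0 < a₁) (h8 : Prop8RegSepPrinted F N B₃ a₀ a₁) :
    2 * (F.L : ℝ) ^ 2 ≤ B₃ :=
  K0VariationalThm1Top7Floor.two_sq_L_le_of_variationalThm1RegSepCo7 hN ha₀ ha₁ (variationalThm1RegSepCo7_of_prop8 h8)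

/-- **`Prop8RegSepStep F N B₃ a₀ a₁ → 2L² ≤ B₃` for `0 < B₃`** (`N ≥ 2`, `0 < a₀`, `0 < a₁`): dag-n07-e `variationalThm1RegSepCo7_of_prop8Step` ∘ FILE 21C's Co7 floor — dag-ref-C g29's
located consequence («refute `Prop8RegSepStep` for `0 < B₃ < 2L²`»). [cite: Balaban1985Variational, Prop. 8 p.304, Thm 1 (7)–(8) pp.278–279 (bookkeeping)] -/
theorem two_sq_L_le_of_prop8RegSepStep (hN : 2 ≤ N) {B₃ a₀ a₁ : ℝ} (ha₀ : 0 < a₀) (ha₁ : 0 < a₁) (hB : 0 < B₃) (h8 : Prop8RegSepStep F N B₃ a₀ a₁) :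
    2 * (F.L : ℝ) ^ 2 ≤ B₃ :=
  K0VariationalThm1Top7Floor.two_sq_L_le_of_variationalThm1RegSepCo7 hN ha₀ ha₁ (variationalThm1RegSepCo7_of_prop8Step hB h8)

/-- Hence `¬ Prop8RegSepStep F N B₃ a₀ a₁` for `0 < B₃ < 2L²` (`N ≥ 2`, `0 < a₀`, `0 < a₁`). [cite: Balaban1985Variational, Prop. 8 p.304 (bookkeeping)] -/
theorem not_prop8RegSepStep_of_pos_of_lt_two_sq (hN : 2 ≤ N) {B₃ a₀ a₁ : ℝ} (ha₀ : 0 < a₀) (ha₁ : 0 < a₁) (hB : 0 < B₃) (hB' : B₃ < 2 * (F.L : ℝ) ^ 2) :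
    ¬ Prop8RegSepStep F N B₃ a₀ a₁ :=
  fun h8 => absurd (two_sq_L_le_of_prop8RegSepStep hN ha₀ ha₁ hB h8) (not_le.mpr hB')

/-- **`Prop8RegSepTopStep F N Sup B₃ a₀ a₁ → 2L² ≤ B₃` AT EVERY TOP DOMAIN** (`N ≥ 2`, `0 < a₀`, `0 < a₁`; no sign on `B₃`): dag-n07-e's top-domain step form of [15] Prop. 8
(`Node00.CriticalOnFibreTop`, guards `0 < ν.M₁`, `1 ≤ k`) supplies the engine's body at `(numerics7OfRecord₁₂, k = 1)` through `regular_of_isMinimizer_classTop_of_prop8TopStep`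
(minimal over the open class ⇒ critical on the fibre) — the floor mode (§3). [cite: Balaban1985Variational, Prop. 8 p.304, Thm 1 (7)–(8) pp.278–279; Balaban1985RegularSpaces, (1.3)–(1.9) p.77 (bookkeeping)] -/
theorem two_sq_L_le_of_prop8RegSepTopStep (Sup : (ν : Stage7Numerics) → (K : ℕ) → (ℕ → Set (Site (F.P K) 0)) → Set (Site (F.P K) 0))
    (hN : 2 ≤ N) {B₃ a₀ a₁ : ℝ} (ha₀ : 0 < a₀) (ha₁ : 0 < a₁) (h8 : Prop8RegSepTopStep F N Sup B₃ a₀ a₁) : 2 * (F.L : ℝ) ^ 2 ≤ B₃ :=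
  two_sq_L_le_of_top7BodyAt_record Sup hN ha₀ ha₁ fun s hsep ε₀ δ hδ hcomp hcomp' hε₀ W h7 U₀ hU₀ =>
    regular_of_isMinimizer_classTop_of_prop8TopStep h8 numerics7OfRecord₁₂ 1 (fun _ => (1 : ℝ)) 1 1 s hsep (by change 0 < 1; exact one_pos) le_rfl ε₀ δ hδ
      hcomp hcomp' hε₀ W h7 hU₀

/-- Hence `¬ Prop8RegSepTopStep F N Sup B₃ a₀ a₁` for every `B₃ < 2L²`, every top domain (`N ≥ 2`, `0 < a₀`, `0 < a₁`). [cite: Balaban1985Variational, Prop. 8 p.304 (bookkeeping)] -/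
theorem not_prop8RegSepTopStep_of_lt_two_sq (Sup : (ν : Stage7Numerics) → (K : ℕ) → (ℕ → Set (Site (F.P K) 0)) → Set (Site (F.P K) 0))
    (hN : 2 ≤ N) {B₃ a₀ a₁ : ℝ} (ha₀ : 0 < a₀) (ha₁ : 0 < a₁) (hB : B₃ < 2 * (F.L : ℝ) ^ 2) : ¬ Prop8RegSepTopStep F N Sup B₃ a₀ a₁ :=
  fun h8 => absurd (two_sq_L_le_of_prop8RegSepTopStep Sup hN ha₀ ha₁ h8) (not_le.mpr hB)

end Prop8

end Summit.QuantumFields.YangMills.Theorems.K0VariationalThm1Top7Engine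

end
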